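import Summits.CriticalPhenomena.PercolationContinuityZ3.Theorems.PercNearOneGluingNoHeavyQuantSliceDeepLowsPool
import HarnessLib

/-!
# QUANT lane R8, T-DEC: SL-λ* for any number of deep lows — the witness flow of the slice and its three loads (LEAD-NOTES-G23 N49, Theorem A)

builds on p205010 (kernel theorem, internal audit signed; external expert review pending)

Support file (`--supports stmt-CriticalPhenomena-4575`), QUANT lane lead seat prim-quant-lead (gen 23), rung R8 of
`run/shared/lean/prim/quant/LADDER.md`.  Four small definitions (the pool masses, the pool-bound sources and the witness flow `dlFlow`) and
theorems; standard axioms, no sorries.  Third file of Theorem A (`…QuantSliceDeepLowsBudget`: statement, routing, key step;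
`…QuantSliceDeepLowsPool`: the pool inequality).
* `dlPool`, `dlPoolTot` (= the typer's giant parts, `sum_giantParts`), `dlSrc` (pool-bound mass leaving a slice position: row-0 copy of a low of
  `(T, j′)` plus the unabsorbed part of the row-1 copy of the low `a` below), **`dlFlow`** (band vertical + anti-diagonals + proportional pool split);
* `sum_dlSrc_le` — the pool-bound sources are (at most) the `dlRest`s of `…Budget`, re-indexed by `q = l + a`;
* the loads on an absorber position `p` of the slice: `loadV_le` (verticals `≤ g·ν_{p−a}`, only when `2(p−a) < T′`, `band_usage_le`),
  `loadA_le` (anti-diagonals `≤ (1−g)·ν_p` on mids, `antiDiag_load_le`), `loadP_le` (pool split `≤ dlPool p` whenever the pool-bound mass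
  fits into the pool — hypothesis `hPB`, supplied by `pool_budget` in Theorem A and by other budgets in its extensions).
The shipping identity and the `IsFlowAtT` assembly are `…QuantSliceDeepLows`.

[this work]; nothing here is cited as a published result.  The gluing rows served [cite: KozmaNitzan2024, Conjecture 3 (p. 15)]; product
measure [cite: Grimmett1999, §1.3 p. 10].
-/

noncomputable section

namespace Summit.CriticalPhenomena.PercolationContinuityZ3.Theorems

namespace Quant

open Finset

namespace LawDec

/-! ### The witness flow of the slice -/

section Witness

variable (x T g : ℝ) (j' M a lam : ℕ) (ν : ℕ → ℝ) (f0 : ℕ → ℕ → ℝ)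

/-- **giant pool mass at a slice position `p`**: `(1−g)·ν_p·[p > j′] + g·ν_{p−a}·[p−a > λ]`. [this work] -/
def dlPool (g : ℝ) (j' a lam : ℕ) (ν : ℕ → ℝ) (p : ℕ) : ℝ :=
  (1 - g) * (if j' + 1 ≤ p then ν p else 0) + g * (if a ≤ p ∧ lam + 1 ≤ p - a then ν (p - a) else 0)

/-- **total pool** `Π = (1−g)·ν(>j′) + g·ν(>λ)`. [this work] -/
def dlPoolTot (g : ℝ) (j' M lam : ℕ) (ν : ℕ → ℝ) : ℝ :=
  (1 - g) * ∑ h ∈ Finset.Ico (j' + 1) (M + 1), ν h + g * ∑ h ∈ Finset.Ico (lam + 1) (M + 1), ν h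

/-- **pool-bound mass leaving the slice position `q`**: the row-0 copy `(1−g)ν_q` of a low `q` of `(T, j′)`, plus the unabsorbed part
`g·ν_{q−a} − Σ_m dlAd (q−a) m` of the row-1 copy of the low `q − a`. [this work] -/
def dlSrc (x T g : ℝ) (j' a : ℕ) (ν : ℕ → ℝ) (f0 : ℕ → ℕ → ℝ) (q : ℕ) : ℝ :=
  (if 2 * (q : ℝ) < T then (1 - g) * ν q else 0)
    + (if a ≤ q then g * ν (q - a) - ∑ m ∈ Finset.range (j' + 1), dlAd x T g j' a ν f0 (q - a) m else 0)

/-- **THE WITNESS FLOW of the slice at `(T′, j′)`** from a low position `q ≤ j′`, `2q < T′`, to `p ≤ M + a`: the band vertical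
`q ↦ q + a` (`T ≤ 2q`), the anti-diagonals `dlAd (q−a) p` (`p ≤ j′`), and the proportional split of `dlSrc q` over the pool. [this work] -/
def dlFlow (x T g : ℝ) (j' M a lam : ℕ) (ν : ℕ → ℝ) (f0 : ℕ → ℕ → ℝ) (q p : ℕ) : ℝ :=
  if q ≤ j' ∧ 2 * (q : ℝ) < T + (a : ℝ) * g ∧ p ≤ M + a then
    (if T ≤ 2 * (q : ℝ) ∧ p = q + a then (1 - g) * ν q else 0)
      + (if a ≤ q ∧ p ≤ j' then dlAd x T g j' a ν f0 (q - a) p else 0)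
      + dlSrc x T g j' a ν f0 q * dlPool g j' a lam ν p / dlPoolTot g j' M lam ν
  else 0

/-! ### Facts about the pieces -/

/-- a low position `q ≥ a` of the slice comes from a low `q − a` of `(T, j′)`: `2q < T + ag`, `a ≥ 1`, `g ≤ 1` ⟹ `2(q − a) < T`. -/
theorem two_mul_sub_lt (ha : 1 ≤ a) (hg1 : g ≤ 1) (q : ℕ) (haq : a ≤ q) (hq : 2 * (q : ℝ) < T + (a : ℝ) * g) :
    2 * (((q - a : ℕ) : ℝ)) < T := by
  have ha' : (1 : ℝ) ≤ a := by exact_mod_cast ha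
  rw [Nat.cast_sub haq]
  nlinarith

/-- the pool vanishes at positions `≤ j′` (as `j′ ≤ λ + a`). -/
theorem dlPool_eq_zero (hlam : j' ≤ lam + a) (p : ℕ) (hp : p ≤ j') : dlPool g j' a lam ν p = 0 := by
  unfold dlPool
  rw [if_neg (by omega), if_neg (by omega)]
  ring

/-- the pool is nonnegative. -/
theorem dlPool_nonneg (hg0 : 0 ≤ g) (hg1 : g ≤ 1) (hν : ∀ k, 0 ≤ ν k) (p : ℕ) : 0 ≤ dlPool g j' a lam ν p := by
  unfold dlPool
  refine add_nonneg (mul_nonneg (by linarith) ?_) (mul_nonneg hg0 ?_) <;> split_ifs <;> first | exact hν _ | exact le_rfl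

/-- a charged pool position is a giant of the slice. -/
theorem giant_of_dlPool_ne (hlam : j' ≤ lam + a) (p : ℕ) (hp : dlPool g j' a lam ν p ≠ 0) : j' + 1 ≤ p := by
  by_contra h
  exact hp (dlPool_eq_zero g j' a lam ν hlam p (by omega))

/-- the total pool is the sum of the pool masses (the typer's `sum_giantParts`). -/
theorem sum_dlPool (hνM : ∀ k, M < k → ν k = 0) :
    ∑ p ∈ Finset.range (M + a + 1), dlPool g j' a lam ν p = dlPoolTot g j' M lam ν := by
  unfold dlPool dlPoolTot
  exact sum_giantParts ν g j' M a lam hνM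

/-- the total pool is nonnegative. -/
theorem dlPoolTot_nonneg (hg0 : 0 ≤ g) (hg1 : g ≤ 1) (hν : ∀ k, 0 ≤ ν k) :
    0 ≤ dlPoolTot g j' M lam ν :=
  add_nonneg (mul_nonneg (by linarith) (Finset.sum_nonneg fun h _ => hν h))
    (mul_nonneg hg0 (Finset.sum_nonneg fun h _ => hν h))

/-- `dlSrc ≥ 0` (the anti-diagonals fit into the row-1 copy, `sum_dlAd_le`). -/
theorem dlSrc_nonneg (hg0 : 0 ≤ g) (hg1 : g ≤ 1) (hν : ∀ k, 0 ≤ ν k) (q : ℕ) : 0 ≤ dlSrc x T g j' a ν f0 q := by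
  unfold dlSrc
  refine add_nonneg ?_ ?_
  · split_ifs
    · exact mul_nonneg (by linarith) (hν q)
    · exact le_rfl
  · split_ifs
    · linarith [sum_dlAd_le x T g j' a ν f0 hg0 hν (q - a)]
    · exact le_rfl

/-- **the pool-bound masses are the `dlRest`s**: `Σ_{low positions q ≤ j′} dlSrc q ≤ Σ_{lows l of (T,j′)} dlRest l` (equality in fact; `≤`
is what the capacity rows need).  The row-1 parts are re-indexed by `q = l + a` (`a ≤ j′`). [this work] -/
theorem sum_dlSrc_le (ha : 1 ≤ a) (haj : a ≤ j') (hg0 : 0 ≤ g) (hg1 : g ≤ 1) (hν : ∀ k, 0 ≤ ν k) :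
    ∑ q ∈ Finset.range (j' + 1), (if 2 * (q : ℝ) < T + (a : ℝ) * g then dlSrc x T g j' a ν f0 q else 0)
      ≤ ∑ l ∈ Finset.range (j' + 1), (if 2 * (l : ℝ) < T then dlRest x T g j' a ν f0 l else 0) := by
  have hag : 0 ≤ (a : ℝ) * g := mul_nonneg (Nat.cast_nonneg a) hg0
  -- row-1 part of dlSrc, as a function of the low l = q - a
  set R1 : ℕ → ℝ := fun l => g * ν l - ∑ m ∈ Finset.range (j' + 1), dlAd x T g j' a ν f0 l m with hR1
  have hR1nn : ∀ l, 0 ≤ R1 l := fun l => by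
    simp only [hR1]; linarith [sum_dlAd_le x T g j' a ν f0 hg0 hν l]
  -- split dlSrc into its two rows under the indicator
  have hsplit : ∀ q ∈ Finset.range (j' + 1), (if 2 * (q : ℝ) < T + (a : ℝ) * g then dlSrc x T g j' a ν f0 q else 0)
      ≤ (if 2 * (q : ℝ) < T then (1 - g) * ν q else 0)
        + (if a ≤ q then (if 2 * (((q - a : ℕ) : ℝ)) < T then R1 (q - a) else 0) else 0) := by
    intro q _
    by_cases hq : 2 * (q : ℝ) < T + (a : ℝ) * g
    · rw [if_pos hq]
      unfold dlSrc
      refine add_le_add le_rfl ?_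
      by_cases haq : a ≤ q
      · rw [if_pos haq, if_pos haq, if_pos (two_mul_sub_lt T g a ha hg1 q haq hq)]
      · rw [if_neg haq, if_neg haq]
    · rw [if_neg hq]
      refine add_nonneg ?_ ?_
      · split_ifs
        · exact mul_nonneg (by linarith) (hν q)
        · exact le_rfl
      · split_ifs
        · exact hR1nn _
        · exact le_rfl
        · exact le_rfl
  refine (Finset.sum_le_sum hsplit).trans ?_
  rw [Finset.sum_add_distrib]
  -- re-index the row-1 part: q = l + a
  have hshift : ∑ q ∈ Finset.range (j' + 1), (if a ≤ q then (if 2 * (((q - a : ℕ) : ℝ)) < T then R1 (q - a) else 0) else 0)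
      = ∑ l ∈ Finset.range (j' - a + 1), (if 2 * (l : ℝ) < T then R1 l else 0) := by
    have e := sum_shift (fun l => if 2 * (l : ℝ) < T then R1 l else 0) (j' - a) a
    rw [show j' - a + a + 1 = j' + 1 by omega] at e
    exact e
  rw [hshift]
  have hsub : ∑ l ∈ Finset.range (j' - a + 1), (if 2 * (l : ℝ) < T then R1 l else 0)
      ≤ ∑ l ∈ Finset.range (j' + 1), (if 2 * (l : ℝ) < T then R1 l else 0) := by
    refine Finset.sum_le_sum_of_subset_of_nonneg (Finset.range_mono (by omega)) fun l _ _ => ?_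
    split_ifs
    · exact hR1nn l
    · exact le_rfl
  refine (add_le_add le_rfl hsub).trans (le_of_eq ?_)
  rw [← Finset.sum_add_distrib]
  refine Finset.sum_congr rfl fun l _ => ?_
  unfold dlRest
  split_ifs
  · simp only [hR1]; ring
  · ring

end Witness

/-! ### The three loads on an absorber position and the shipping identity -/

section Loads

variable (x T g : ℝ) (j' M a lam : ℕ) (ν : ℕ → ℝ) (f0 : ℕ → ℕ → ℝ)

/-- **vertical load**: the band verticals arriving at `p` consume at most `g·ν_{p−a}`, and only when `2(p−a) < T′`. [this work] -/
theorem loadV_le (hx0 : 0 < x) (hxg : x ≤ g) (hg1 : g ≤ 1) (ha : 1 ≤ a) (hν : ∀ k, 0 ≤ ν k) (p : ℕ) :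
    ∑ q ∈ Finset.range (j' + 1), (if q ≤ j' ∧ 2 * (q : ℝ) < T + (a : ℝ) * g ∧ p ≤ M + a then
        usage x (T + (a : ℝ) * g) j' q p * (if T ≤ 2 * (q : ℝ) ∧ p = q + a then (1 - g) * ν q else 0) else 0)
      ≤ g * (if a ≤ p ∧ p - a ≤ j' ∧ 2 * (((p - a : ℕ) : ℝ)) < T + (a : ℝ) * g then ν (p - a) else 0) := by
  have hg0 : 0 ≤ g := hx0.le.trans hxg
  have hrhs : 0 ≤ g * (if a ≤ p ∧ p - a ≤ j' ∧ 2 * (((p - a : ℕ) : ℝ)) < T + (a : ℝ) * g then ν (p - a) else 0) :=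
    mul_nonneg hg0 (by split_ifs <;> first | exact hν _ | exact le_rfl)
  rw [Finset.sum_eq_single (p - a)]
  · by_cases hg : (p - a) ≤ j' ∧ 2 * (((p - a : ℕ) : ℝ)) < T + (a : ℝ) * g ∧ p ≤ M + a
    · rw [if_pos hg]
      by_cases hv : T ≤ 2 * (((p - a : ℕ) : ℝ)) ∧ p = (p - a) + a
      · rw [if_pos hv, if_pos ⟨by omega, hg.1, hg.2.1⟩]
        have hb := band_usage_le x T g j' (p - a) a (ν (p - a)) (hν _) hx0 hxg hg1 ha hv.1
        rw [← hv.2] at hb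
        exact hb
      · rw [if_neg hv, mul_zero]; exact hrhs
    · rw [if_neg hg]; exact hrhs
  · intro q _ hne
    split_ifs with h1 h2
    · exfalso; exact hne (by omega)
    · rw [mul_zero]
    · rfl
  · intro hnot
    rw [if_neg]
    rintro ⟨hq, -, -⟩
    exact hnot (Finset.mem_range.2 (by omega))

/-- the anti-diagonal term at `(l + a, p)` is nonnegative. -/
theorem usage_mul_dlAd_nonneg (hx0 : 0 < x) (hx1 : x < 1) (hg0 : 0 ≤ g) (hg1 : g ≤ 1) (hν : ∀ k, 0 ≤ ν k)
    (hf0 : IsFlowAtT x T j' M ν f0)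
    (hdeep : ∀ k, k ≤ j' → 2 * (k : ℝ) < T → ν k ≠ 0 → 2 * ((k : ℝ) + a) < T + (a : ℝ) * g ∧ k + a ≤ j') (l p : ℕ) :
    0 ≤ usage x (T + (a : ℝ) * g) j' (l + a) p * dlAd x T g j' a ν f0 l p := by
  have hpos := dl_pos x T g j' M a ν f0 hx0 hx1 hg1 hf0 hdeep
  obtain ⟨had0, -⟩ := dlAd_nonneg_le x T g j' a ν f0 hg0 hg1 hν hpos l p
  rcases had0.eq_or_lt with hz | hp
  · rw [← hz, mul_zero]
  · have hc : p ≤ j' ∧ 0 < f0 l p := by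
      by_contra hc
      rw [dlAd_eq_zero x T g j' a ν f0 l p hc] at hp
      exact lt_irrefl _ hp
    exact (mul_pos (hpos l p hc.1 hc.2).2 hp).le

/-- **anti-diagonal load**: at most `(1−g)·ν_p` on a mid position `p ≤ j′` (`T ≤ 2p`), nothing above `j′` (`a ≤ j′`). [this work] -/
theorem loadA_le (hx0 : 0 < x) (hx1 : x < 1) (hg0 : 0 ≤ g) (hg1 : g ≤ 1) (haj : a ≤ j') (hν : ∀ k, 0 ≤ ν k)
    (hf0 : IsFlowAtT x T j' M ν f0)
    (hdeep : ∀ k, k ≤ j' → 2 * (k : ℝ) < T → ν k ≠ 0 → 2 * ((k : ℝ) + a) < T + (a : ℝ) * g ∧ k + a ≤ j')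
    (p : ℕ) (hp : j' + 1 ≤ p ∨ T ≤ 2 * (p : ℝ)) :
    ∑ q ∈ Finset.range (j' + 1), (if q ≤ j' ∧ 2 * (q : ℝ) < T + (a : ℝ) * g ∧ p ≤ M + a then
        usage x (T + (a : ℝ) * g) j' q p * (if a ≤ q ∧ p ≤ j' then dlAd x T g j' a ν f0 (q - a) p else 0) else 0)
      ≤ (if p ≤ j' then (1 - g) * ν p else 0) := by
  set G : ℕ → ℝ := fun l => usage x (T + (a : ℝ) * g) j' (l + a) p * dlAd x T g j' a ν f0 l p with hG
  have hGnn : ∀ l, 0 ≤ G l := fun l => usage_mul_dlAd_nonneg x T g j' M a ν f0 hx0 hx1 hg0 hg1 hν hf0 hdeep l p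
  by_cases hpj : p ≤ j'
  · rw [if_pos hpj]
    have hp2 : T ≤ 2 * (p : ℝ) := by
      rcases hp with hp | hp
      · omega
      · exact hp
    -- termwise: ≤ [a ≤ q]·G(q − a)
    have hterm : ∀ q ∈ Finset.range (j' + 1),
        (if q ≤ j' ∧ 2 * (q : ℝ) < T + (a : ℝ) * g ∧ p ≤ M + a then
          usage x (T + (a : ℝ) * g) j' q p * (if a ≤ q ∧ p ≤ j' then dlAd x T g j' a ν f0 (q - a) p else 0) else 0)
        ≤ (if a ≤ q then G (q - a) else 0) := by
      intro q _
      by_cases haq : a ≤ q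
      · rw [if_pos haq]
        have e : usage x (T + (a : ℝ) * g) j' q p = usage x (T + (a : ℝ) * g) j' ((q - a) + a) p := by
          rw [Nat.sub_add_cancel haq]
        split_ifs with h1 h2
        · rw [e]
        · rw [mul_zero]; exact hGnn _
        · exact hGnn _
      · rw [if_neg haq]
        split_ifs with h1 h2
        · exact absurd h2.1 haq
        · rw [mul_zero]
        · exact le_rfl
    refine (Finset.sum_le_sum hterm).trans ?_
    have hshift := sum_shift G (j' - a) a
    rw [show j' - a + a + 1 = j' + 1 by omega] at hshift
    rw [hshift]
    refine le_trans (Finset.sum_le_sum_of_subset_of_nonneg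
      (Finset.range_mono (show j' - a + 1 ≤ j' + 1 by omega)) fun l _ _ => hGnn l) ?_
    exact antiDiag_load_le x T g j' M a ν f0 hx0 hx1 hg0 hg1 hν hf0 hdeep p hp2
  · rw [if_neg hpj]
    refine (Finset.sum_eq_zero fun q _ => ?_).le
    split_ifs with h1 h2
    · exact absurd h2.2 hpj
    · rw [mul_zero]
    · rfl

/-- **pool load**: if the pool-bound mass fits into the pool (`hPB`, e.g. `pool_budget`), the pool split arriving at `p` consumes at most
`dlPool p`. [this work] -/
theorem loadP_le (hx0 : 0 < x) (hx1 : x < 1) (hxg : x ≤ g) (hg1 : g ≤ 1)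
    (ha : 1 ≤ a) (haj : a ≤ j') (hν : ∀ k, 0 ≤ ν k) (hνM : ∀ k, M < k → ν k = 0) (hlam : j' ≤ lam + a)
    (hPB : x / (1 - x) * ∑ l ∈ Finset.range (j' + 1), (if 2 * (l : ℝ) < T then dlRest x T g j' a ν f0 l else 0)
      ≤ dlPoolTot g j' M lam ν)
    (p : ℕ) (hpM : p ≤ M + a) :
    ∑ q ∈ Finset.range (j' + 1), (if q ≤ j' ∧ 2 * (q : ℝ) < T + (a : ℝ) * g ∧ p ≤ M + a then
        usage x (T + (a : ℝ) * g) j' q p * (dlSrc x T g j' a ν f0 q * dlPool g j' a lam ν p / dlPoolTot g j' M lam ν) else 0)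
      ≤ dlPool g j' a lam ν p := by
  have hg0 : 0 ≤ g := hx0.le.trans hxg
  have hpool0 := dlPool_nonneg g j' a lam ν hg0 hg1 hν p
  rcases hpool0.eq_or_lt with hz | hpos
  · -- empty pool position: nothing arrives
    rw [← hz]
    refine (Finset.sum_eq_zero fun q _ => ?_).le
    split_ifs
    · rw [mul_zero, zero_div, mul_zero]
    · rfl
  · have hgi : j' + 1 ≤ p := giant_of_dlPool_ne g j' a lam ν hlam p hpos.ne'
    have hu : 0 < x / (1 - x) := div_pos hx0 (by linarith)
    -- the total pool dominates this position, hence is positive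
    have htot : dlPool g j' a lam ν p ≤ dlPoolTot g j' M lam ν := by
      rw [← sum_dlPool g j' M a lam ν hνM]
      exact Finset.single_le_sum (f := fun p => dlPool g j' a lam ν p)
        (fun q _ => dlPool_nonneg g j' a lam ν hg0 hg1 hν q) (Finset.mem_range.2 (by omega))
    have htpos : 0 < dlPoolTot g j' M lam ν := lt_of_lt_of_le hpos htot
    -- rewrite the sum: giant usage, guard = [2q < T′]
    have e : ∀ q ∈ Finset.range (j' + 1), (if q ≤ j' ∧ 2 * (q : ℝ) < T + (a : ℝ) * g ∧ p ≤ M + a then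
        usage x (T + (a : ℝ) * g) j' q p * (dlSrc x T g j' a ν f0 q * dlPool g j' a lam ν p / dlPoolTot g j' M lam ν) else 0)
        = (x / (1 - x) * (dlPool g j' a lam ν p / dlPoolTot g j' M lam ν))
          * (if 2 * (q : ℝ) < T + (a : ℝ) * g then dlSrc x T g j' a ν f0 q else 0) := by
      intro q hq
      have hqj : q ≤ j' := Nat.lt_succ_iff.1 (Finset.mem_range.1 hq)
      by_cases hlow : 2 * (q : ℝ) < T + (a : ℝ) * g
      · rw [if_pos ⟨hqj, hlow, hpM⟩, if_pos hlow, usage_giant_eq x _ j' q p hgi]; ring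
      · rw [if_neg (fun h => hlow h.2.1), if_neg hlow, mul_zero]
    rw [Finset.sum_congr rfl e, ← Finset.mul_sum]
    have hS := sum_dlSrc_le x T g j' a ν f0 ha haj hg0 hg1 hν
    have hkey : x / (1 - x) * ∑ q ∈ Finset.range (j' + 1),
        (if 2 * (q : ℝ) < T + (a : ℝ) * g then dlSrc x T g j' a ν f0 q else 0) ≤ dlPoolTot g j' M lam ν :=
      (mul_le_mul_of_nonneg_left hS hu.le).trans hPB
    calc x / (1 - x) * (dlPool g j' a lam ν p / dlPoolTot g j' M lam ν)
          * ∑ q ∈ Finset.range (j' + 1), (if 2 * (q : ℝ) < T + (a : ℝ) * g then dlSrc x T g j' a ν f0 q else 0)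
        = (x / (1 - x) * ∑ q ∈ Finset.range (j' + 1),
            (if 2 * (q : ℝ) < T + (a : ℝ) * g then dlSrc x T g j' a ν f0 q else 0))
            * dlPool g j' a lam ν p / dlPoolTot g j' M lam ν := by ring
      _ ≤ dlPoolTot g j' M lam ν * dlPool g j' a lam ν p / dlPoolTot g j' M lam ν := by
            refine div_le_div_of_nonneg_right (mul_le_mul_of_nonneg_right hkey hpool0) htpos.le
      _ = dlPool g j' a lam ν p := by field_simp

end Loads

end LawDec

end Quant

end Summit.CriticalPhenomena.PercolationContinuityZ3.Theorems
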